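import Summits.QuantumFields.YangMills.Theorems.SwapVirialDeficitSectorLaplaceTipWindowReading
import Summits.QuantumFields.YangMills.Theorems.SwapVirialDeficitSectorLaplaceTipShellDischarge
import HarnessLib

/-!
# Route `SwapVirialDeficit` (YangMills): THE TIP-MID SIDE OF T-N6b DISCHARGED — the tip-mid window through the bulk law, split over a base box
# (cell ym-idea-1, skeleton ➎ v14 (ONE sorry: `stub_core_tip`); the producer side of g49's `hMid` socket: w3 g68's readings ✓`tipWindow_eq_integral_hubIntegral`,
# ✓`hubIntegral_hubAt_two_sided` and the layer ✓`tipMid_le_shell_of_pointwise`; free-hands support of ⟨stmt-QuantumFields-24197⟩ `SwapVirialDeficit.SwapGluedStiffness`)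

On a tip-mid window `Mid` inside the bulk window of a (small) cut `ψ` — e.g. `Mid = Ioc δ_τ δ_b`, `ψ = (1+δ_b²)⁻¹` — the bulk law ✓`bulk_fibred_plane` holds at every hub
`hubAt δ 1`, `δ ∈ Mid`, above ITS threshold `b ≥ (K L^k ψ^{−k})²`.  Integrating its upper half against the tip weight `((1+δ²)⁻¹)²` and splitting the plane mass over a
measurable `Box` (✓`integral_add_compl`):
★★ `tipMid_window_le` — `coneConst·π·∫_{Mid}((1+δ²)⁻¹)²·I(hubAt δ 1, ε; b)
   ≤ (1 + K L^k ψ^{−k} b^{−1/2})·(2π/b)^α·coneConst·π·(∫_{Mid}((1+δ²)⁻¹)²∫_{Box}𝔪 + ∫_{Mid}((1+δ²)⁻¹)²∫_{Boxᶜ}𝔪) + (∫ρ)·e^{−b(ψ/(KL^k))^k}·coneConst·π·∫_{Mid}((1+δ²)⁻¹)²`,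
with the SAME `K, k` for all windows (those of ✓`hubIntegral_hubAt_two_sided`).  The first box term is the input of ✓`tipMid_le_shell_of_pointwise` (→ shell → bulk by
✓`shell_boxMass_le_mbMain`); the `Boxᶜ` term is the corner ∕ ends mass (memo2 §2, P6; LEAD 00:37Z ruling (2)); the last term is the off-tube tail (`∫_{Mid}((1+δ²)⁻¹)² ≤ δ_τ⁻¹`).
Helpers: `integrableOn_sqInv` (the weight is integrable), `planeMass_eq_box_add_compl`.

HONEST LABEL: plumbing; (H′) (w2 g61), the `Boxᶜ` mass, tip-core `δ > δ_b`, the `δ < 0` half, thresholds and the assembly of `hT` (g49's plug) remain; `stub_core_tip`,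
⟨24197⟩ ∕ ⟨24194⟩ OPEN; own crux ⟨22884⟩ `LargeFieldMassRefinementTail` OPEN (blocked-on ⟨19935⟩); the Yang–Mills mass gap is NOT proved; no summit is proved by a line.
THEOREMS ONLY (0 `def`, 0 `sorry`, no instance), standard axioms.  Width seat ym-line-sfw-p2-w3 g68 (cell ym-idea-1, free hands), `--supports stmt-QuantumFields-24197`.
References: [cite: Luscher1983, §2]; [folklore].
-/

set_option autoImplicit false
set_option synthInstance.maxSize 1024

noncomputable section

open MeasureTheory Quaternion Set Filter
open scoped Quaternion BigOperators ENNReal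
open Literature.MathematicalPhysics.QuantumLattice
open Literature.MathematicalPhysics.QuantumFieldTheory hiding SU2
open Summit.QuantumFields.YangMills.Theorems.SwapTwistDeficit.ToronLog

namespace Summit.QuantumFields.YangMills.Theorems.SwapVirialDeficit.SectorLaplace

open Summit.QuantumFields.YangMills.Theorems.FemtoTransferGap
open Summit.QuantumFields.YangMills.Theorems.FemtoTransferGap.TT
open Summit.QuantumFields.YangMills.Theorems.VirialFluxGap.RingDeficit
open Summit.QuantumFields.YangMills.Theorems.SwapVirialDeficit.SwapRing
open Summit.QuantumFields.YangMills.Theorems.SwapVirialDeficit.BlowUpRing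

variable {L : ℕ} [NeZero L]

omit [NeZero L] in
/-- The tip weight `((1+δ²)⁻¹)²` is integrable on `ℝ` (`≤ (1+δ²)⁻¹`). [folklore] -/
theorem integrableOn_sqInv (S : Set ℝ) : IntegrableOn (fun δ : ℝ => ((1 + δ ^ 2)⁻¹) ^ 2) S := by
  refine (integrable_inv_one_add_sq.mono' ?_ (Eventually.of_forall fun δ => ?_)).integrableOn
  · exact (((measurable_const.add (measurable_id.pow_const 2)).inv).pow_const 2).aestronglyMeasurable
  · have h1 : (1 + δ ^ 2)⁻¹ ≤ 1 := inv_le_one_of_one_le₀ (by nlinarith [sq_nonneg δ])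
    have h0 : 0 ≤ (1 + δ ^ 2)⁻¹ := by positivity
    rw [Real.norm_eq_abs, abs_of_nonneg (by positivity), sq]
    exact mul_le_of_le_one_left h0 h1

/-- The plane mass splits over a measurable box: `∫_{ℝ²}𝔪(hubAt δ 1) = ∫_{Box}𝔪 + ∫_{Boxᶜ}𝔪` for `δ` in the bulk window of a cut `0 < ψ ≤ 1`, good `ε`. [folklore] -/
theorem planeMass_eq_box_add_compl {ε : GnoSign L} (hε : GoodSign ε) {ψ : ℝ} (hψ : 0 < ψ) (hψ1 : ψ ≤ 1) {δ : ℝ}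
    (hδ : ψ ≤ 4 * δ ^ 2 / (1 + δ ^ 2) ^ 2 ∧ ψ ≤ (1 + δ ^ 2)⁻¹) {Box : Set (ℝ × ℝ)} (hBox : MeasurableSet Box) :
    ∫ p : ℝ × ℝ, mbDensity (L := L) (hubAt δ 1) ε p =
      (∫ p in Box, mbDensity (L := L) (hubAt δ 1) ε p) + ∫ p in Boxᶜ, mbDensity (L := L) (hubAt δ 1) ε p :=
  (integral_add_compl hBox (integrable_mbDensity_hubAt_of_window hε hψ hψ1 hδ)).symm

/-- ★★ **THE TIP-MID WINDOW THROUGH THE BULK LAW, SPLIT OVER A BOX.**  With the constants `K, k` of ✓`hubIntegral_hubAt_two_sided` (= those of ✓`bulk_fibred_plane`): for every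
cut `0 < ψ ≤ 1`, `b ≥ (K L^k ψ^{−k})²`, good `ε`, every measurable `Mid` inside the bulk window of `ψ` and every measurable `Box`,
`cc·π·∫_{Mid}((1+δ²)⁻¹)²·I(hubAt δ 1) ≤ (1+E)·(2π/b)^α·cc·π·(∫_{Mid}((1+δ²)⁻¹)²∫_{Box}𝔪 + ∫_{Mid}((1+δ²)⁻¹)²∫_{Boxᶜ}𝔪) + T·cc·π·∫_{Mid}((1+δ²)⁻¹)²`,
`E = K L^k ψ^{−k} b^{−1/2}`, `T = (∫ρ)·e^{−b(ψ/(KL^k))^k}`. [cite: Luscher1983, §2] -/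
theorem tipMid_window_le : ∃ K : ℝ, 0 < K ∧ ∃ k : ℕ, ∀ (L : ℕ) [NeZero L] (ψ b : ℝ), 0 < ψ → ψ ≤ 1 →
    (K * (L : ℝ) ^ k * (1 / ψ) ^ k) ^ 2 ≤ b → ∀ ε : GnoSign L, GoodSign ε →
    ∀ Mid : Set ℝ, MeasurableSet Mid → Mid ⊆ {δ : ℝ | ψ ≤ 4 * δ ^ 2 / (1 + δ ^ 2) ^ 2 ∧ ψ ≤ (1 + δ ^ 2)⁻¹} →
    ∀ Box : Set (ℝ × ℝ), MeasurableSet Box →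
      coneConst * Real.pi * ∫ δ in Mid, ((1 + δ ^ 2)⁻¹) ^ 2 * hubIntegral (L := L) (hubAt δ 1) ε b ≤
        (1 + K * (L : ℝ) ^ k * (1 / ψ) ^ k * b ^ (-(1 / 2 : ℝ))) * (2 * Real.pi / b) ^ alpha L *
            (coneConst * Real.pi * ((∫ δ in Mid, ((1 + δ ^ 2)⁻¹) ^ 2 * ∫ p in Box, mbDensity (L := L) (hubAt δ 1) ε p) +
              ∫ δ in Mid, ((1 + δ ^ 2)⁻¹) ^ 2 * ∫ p in Boxᶜ, mbDensity (L := L) (hubAt δ 1) ε p)) +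
          (∫ η : GnoCoord L, gnoDensity η) * Real.exp (-(b * (ψ / (K * (L : ℝ) ^ k)) ^ k)) *
            (coneConst * Real.pi * ∫ δ in Mid, ((1 + δ ^ 2)⁻¹) ^ 2) := by
  obtain ⟨K, hK, k, hlaw⟩ := hubIntegral_hubAt_two_sided
  refine ⟨K, hK, k, fun L _ ψ b hψ hψ1 hb ε hε Mid hMid hMidW Box hBox => ?_⟩
  have hL : (0 : ℝ) < (L : ℝ) := Nat.cast_pos.2 (Nat.pos_of_ne_zero (NeZero.ne L))
  -- the threshold gives `b ≥ 1`
  have hψinv : 1 ≤ 1 / ψ := by rw [le_div_iff₀ hψ, one_mul]; exact hψ1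
  have hb0 : 0 < b := by
    have h1 : 0 < (K * (L : ℝ) ^ k * (1 / ψ) ^ k) ^ 2 := by positivity
    linarith
  set E : ℝ := K * (L : ℝ) ^ k * (1 / ψ) ^ k * b ^ (-(1 / 2 : ℝ)) with hE
  set A : ℝ := (2 * Real.pi / b) ^ alpha L with hA
  set T : ℝ := (∫ η : GnoCoord L, gnoDensity η) * Real.exp (-(b * (ψ / (K * (L : ℝ) ^ k)) ^ k)) with hT
  have hE0 : 0 ≤ E := by rw [hE]; positivity
  have hA0 : 0 ≤ A := by rw [hA]; exact Real.rpow_nonneg (by positivity) _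
  have hT0 : 0 ≤ T := by rw [hT]; exact mul_nonneg (integral_nonneg fun η => (gnoDensity_pos η).le) (Real.exp_pos _).le
  have hcc : 0 < coneConst * Real.pi := mul_pos coneConst_pos Real.pi_pos
  -- the pointwise law on the window, box-split
  have hpt : ∀ δ ∈ Mid, ((1 + δ ^ 2)⁻¹) ^ 2 * hubIntegral (L := L) (hubAt δ 1) ε b ≤
      (1 + E) * A * (((1 + δ ^ 2)⁻¹) ^ 2 * ∫ p in Box, mbDensity (L := L) (hubAt δ 1) ε p) +
        (1 + E) * A * (((1 + δ ^ 2)⁻¹) ^ 2 * ∫ p in Boxᶜ, mbDensity (L := L) (hubAt δ 1) ε p) + T * ((1 + δ ^ 2)⁻¹) ^ 2 := by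
    intro δ hδ
    have hw := hMidW hδ
    have h := (hlaw L ψ b hψ hψ1 hb δ hw.1 hw.2 ε hε).1
    rw [planeMass_eq_box_add_compl hε hψ hψ1 hw hBox] at h
    have hw0 : 0 ≤ ((1 + δ ^ 2)⁻¹) ^ 2 := by positivity
    have h2 := mul_le_mul_of_nonneg_left h hw0
    refine h2.trans (le_of_eq ?_)
    rw [hE, hA, hT]; ring
  -- integrability on the window
  have hIL : IntegrableOn (fun δ : ℝ => ((1 + δ ^ 2)⁻¹) ^ 2 * hubIntegral (L := L) (hubAt δ 1) ε b) Mid :=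
    (integrable_sqInv_mul_hubIntegral_hubAt (L := L) ε hb0.le).integrableOn
  have hIB : IntegrableOn (fun δ : ℝ => ((1 + δ ^ 2)⁻¹) ^ 2 * ∫ p in Box, mbDensity (L := L) (hubAt δ 1) ε p) Mid :=
    (integrableOn_sqInv_mul_boxMass hε hψ hψ1 Box).mono_set hMidW
  have hIC : IntegrableOn (fun δ : ℝ => ((1 + δ ^ 2)⁻¹) ^ 2 * ∫ p in Boxᶜ, mbDensity (L := L) (hubAt δ 1) ε p) Mid :=
    (integrableOn_sqInv_mul_boxMass hε hψ hψ1 Boxᶜ).mono_set hMidW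
  have hIw : IntegrableOn (fun δ : ℝ => ((1 + δ ^ 2)⁻¹) ^ 2) Mid := integrableOn_sqInv Mid
  have hI12 : IntegrableOn (fun δ : ℝ => (1 + E) * A * (((1 + δ ^ 2)⁻¹) ^ 2 * ∫ p in Box, mbDensity (L := L) (hubAt δ 1) ε p) +
      (1 + E) * A * (((1 + δ ^ 2)⁻¹) ^ 2 * ∫ p in Boxᶜ, mbDensity (L := L) (hubAt δ 1) ε p)) Mid :=
    (hIB.const_mul _).add (hIC.const_mul _)
  have hI3 : IntegrableOn (fun δ : ℝ => T * ((1 + δ ^ 2)⁻¹) ^ 2) Mid := hIw.const_mul _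
  have hIR : IntegrableOn (fun δ : ℝ => (1 + E) * A * (((1 + δ ^ 2)⁻¹) ^ 2 * ∫ p in Box, mbDensity (L := L) (hubAt δ 1) ε p) +
      (1 + E) * A * (((1 + δ ^ 2)⁻¹) ^ 2 * ∫ p in Boxᶜ, mbDensity (L := L) (hubAt δ 1) ε p) + T * ((1 + δ ^ 2)⁻¹) ^ 2) Mid :=
    hI12.add hI3
  have hmono := setIntegral_mono_on hIL hIR hMid hpt
  have e1 : ∫ δ in Mid, ((1 + E) * A * (((1 + δ ^ 2)⁻¹) ^ 2 * ∫ p in Box, mbDensity (L := L) (hubAt δ 1) ε p) +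
      (1 + E) * A * (((1 + δ ^ 2)⁻¹) ^ 2 * ∫ p in Boxᶜ, mbDensity (L := L) (hubAt δ 1) ε p) + T * ((1 + δ ^ 2)⁻¹) ^ 2) =
      (1 + E) * A * (∫ δ in Mid, ((1 + δ ^ 2)⁻¹) ^ 2 * ∫ p in Box, mbDensity (L := L) (hubAt δ 1) ε p) +
        (1 + E) * A * (∫ δ in Mid, ((1 + δ ^ 2)⁻¹) ^ 2 * ∫ p in Boxᶜ, mbDensity (L := L) (hubAt δ 1) ε p) +
        T * ∫ δ in Mid, ((1 + δ ^ 2)⁻¹) ^ 2 := by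
    rw [integral_add hI12 hI3, integral_add (hIB.const_mul _) (hIC.const_mul _), integral_const_mul, integral_const_mul, integral_const_mul]
  rw [e1] at hmono
  have h3 := mul_le_mul_of_nonneg_left hmono hcc.le
  refine h3.trans (le_of_eq ?_)
  ring

end Summit.QuantumFields.YangMills.Theorems.SwapVirialDeficit.SectorLaplace

end
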